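import Summits.NavierStokesRegularity.NavierStokesRegularity.Theorems.StrainDoorsSliceSuperlevelRigidity
import Summits.NavierStokesRegularity.NavierStokesRegularity.Theorems.StrainDoorsZoomMeasure
import HarnessLib

/-!
# Strain doors, PART M §M33 — door Y_μ (the similarity-scale superlevel-MEASURE floor of the vorticity at sup-Type-I
# singular points) reduced to door X; Y_μ ⇒ Y∞; door Y_ens (local enstrophy floor) from Y_μ by Chebyshev

ROUND 72 of the `ns-regularity-ideate` p1 line (helper lane of `stmt-NavierStokesRegularity-0056`, rung N0;
nothing here is a claim about Navier–Stokes regularity — a-priori STRUCTURE of a HYPOTHETICAL singularity of a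
solution which is Type I in the sup-norm; nothing about Type II).

PART M §M33 — door **Y_μ**: at a singular point `(T,x₀)` of a classical Leray–Hopf solution on `[0,T)` with the
global sup-norm Type-I bound `|u| ≤ M/√(T − t)`, for ALL `t` close to `T` the scaled vorticity superlevel set
`{x ∈ B(x₀, R√(T − t)) : (T − t)|ω(x,t)| > d}` has Lebesgue measure `≥ μ (T − t)^{3/2}` — constants `R, d, μ`
depending on `M` ONLY.  It implies door Y∞ of ROUND 71 (non-emptiness, `SliceVorticityFloorSupTypeI`) and, by
Chebyshev, the local ENSTROPHY floor Y_ens `∫_{B(x₀,R√(T−t))}|ω(t)|² ≥ e(M)/√(T − t)` (the sup-norm-class,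
`M`-only, every-time counterpart of Barker–Prange 2021, Remark 5, which is stated for suitable solutions with
`‖u‖_{L^∞_t L^{3,∞}_x} ≤ M`, a.e. `t`, explicit `S♯(M) = O(1)M^{-100}`).  Mechanism: bad slices `s_n → T` ⇒ zoom
with the slice placed at the rescaled time `−4q²` (`exists_zoomLimit_at_singular_along_scaled`, ROUND 71) ⇒ the
door set at time `s_j` is the `λ_j`-zoom of a superlevel set of the rescaled vorticity (`volume_superlevel_zoom_lt`
of `StrainDoorsZoomMeasure`) ⇒ by the FATOU LEMMA FOR STRICT SUPERLEVEL SETS under the pointwise convergence of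
the rescaled vorticities (`measure_superlevel_le_of_tendsto` below: no measurability, no vorticity-gradient bound)
the limit `U ∈ A_M` has `|{y ∈ B(0,ρ) : |curl U(−4q²)(y)| > η}| ≤ μ₀`, AND — door X (ROUND 70) at the rescaled
times `T − 2λ_j²` — `∫_{B̄(0,R_m√2)}|U(−2)|³ ≥ γ`; the MEASURE RIGIDITY in `A_M` `smallSuperlevel_forces_smallMass`
(`StrainDoorsSliceSuperlevelRigidity`: spreading device + the pointwise rigidity of ROUND 71) says `< γ`:
contradiction.

THIS FILE (text N13a of ROUND 72): §M33(a) `measure_superlevel_le_of_tendsto`; §M33(c) the typed door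
`SliceVorticitySuperlevelSupTypeI` (Y_μ) and ★★★ `sliceVorticitySuperlevelSupTypeI_of_sliceL3Concentration :
SliceL3Concentration → SliceVorticitySuperlevelSupTypeI`; §M33(d) `sliceVorticityFloorSupTypeI_of_superlevel :
Y_μ → Y∞`; §M33(e) the typed door `SliceEnstrophyFloorSupTypeI` (Y_ens) and
`sliceEnstrophyFloorSupTypeI_of_superlevel : Y_μ → Y_ens`.  (§M33(b), an alternative proof of the measure rigidity
by a second compactness pass instead of the spreading device, is not landed: the tree's
`smallSuperlevel_forces_smallMass` is used by name.)  Two definitions (parameterless `Prop`s, no cite tag, sources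
in prose).  No `sorry`, no new axioms.  The unconditional corollaries (`…_holds`, through door X
`sliceL3Concentration_holds`) are text N13b `StrainDoorsDoorYmuClosed`.

References: Barker–Prange, Comm. Math. Phys. 385 (2021) 717–792 (arXiv:2003.06717) p. 6, Remark 5, Lemma 4,
Thm 3; Barker–Prange, Arch. Ration. Mech. Anal. 2020 (arXiv:1906.08225) §4–§5; Albritton–Bradshaw,
arXiv:2110.02187, Def. 1.1, Cor. 1.3; Bradshaw–Farhat–Grujić, ARMA 231 (2019) (arXiv:1704.05546) Thm 26;
Grujić, Nonlinearity 26 (2013) 289; Koch–Nadirashvili–Seregin–Šverák, Acta Math. 203 (2009), Remark 6.1.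
-/

noncomputable section
set_option linter.dupNamespace false
open MeasureTheory Set Function Filter Metric Real InnerProductSpace
open _root_.Topology
open scoped ENNReal NNReal RealInnerProductSpace ContDiff
open Literature.Analysis Literature.Analysis.FluidPDE Literature.Analysis.FluidPDE.LocalTypeIBlowup

namespace Summit.NavierStokesRegularity.NavierStokesRegularity.Theorems.StrainDoors

/-! ### §M33(a) A Fatou lemma for strict superlevel sets -/

/-- **UPPER semicontinuity of the measure of a STRICT superlevel set under pointwise convergence.**  If
`f_j → g` pointwise on `S` and eventually `μ {y ∈ S : θ < f_j y} ≤ ε`, then `μ {y ∈ S : θ < g y} ≤ ε`.  No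
measurability is assumed (continuity of an outer measure from below along a monotone union,
`Monotone.measure_iUnion`): `{θ < g} ∩ S ⊆ ⋃_N B_N`, `B_N = {y ∈ S : θ < f_j y ∀ j ≥ N + N₀} ⊆ {θ < f_{N+N₀}} ∩ S`.
[folklore] -/
theorem measure_superlevel_le_of_tendsto {α : Type*} [MeasurableSpace α] {μ : Measure α}
    {f : ℕ → α → ℝ} {g : α → ℝ} {S : Set α} {θ : ℝ} {ε : ℝ≥0∞}
    (hlim : ∀ y ∈ S, Tendsto (fun j => f j y) atTop (𝓝 (g y)))
    (hbound : ∀ᶠ j in atTop, μ {y ∈ S | θ < f j y} ≤ ε) :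
    μ {y ∈ S | θ < g y} ≤ ε := by
  obtain ⟨N₀, hN₀⟩ := eventually_atTop.1 hbound
  set B : ℕ → Set α := fun N => {y ∈ S | ∀ j, N + N₀ ≤ j → θ < f j y} with hBdef
  have hmono : Monotone B := by
    intro N N' hNN' y hy
    exact ⟨hy.1, fun j hj => hy.2 j (by omega)⟩
  have hsub : {y ∈ S | θ < g y} ⊆ ⋃ N, B N := by
    intro y hy
    obtain ⟨N, hN⟩ := eventually_atTop.1 ((hlim y hy.1).eventually (lt_mem_nhds hy.2))
    rw [mem_iUnion]
    refine ⟨N, hy.1, fun j hj => hN j ?_⟩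
    omega
  have hBle : ∀ N, μ (B N) ≤ ε := fun N => by
    refine le_trans (measure_mono ?_) (hN₀ (N + N₀) (by omega))
    intro y hy
    exact ⟨hy.1, hy.2 (N + N₀) le_rfl⟩
  calc μ {y ∈ S | θ < g y} ≤ μ (⋃ N, B N) := measure_mono hsub
    _ = ⨆ N, μ (B N) := hmono.measure_iUnion
    _ ≤ ε := iSup_le hBle

/-! ### §M33(c) Door Y_μ — the `M`-only similarity-scale MEASURE floor of the vorticity superlevel set -/

/-- ★ door **Y_μ** («SIMILARITY-SCALE SUPERLEVEL-MEASURE FLOOR UNDER THE SUP-NORM TYPE-I RATE»).  For every `M`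
there are `R = R(M)`, `d = d(M)`, `μ = μ(M) > 0`, depending on `M` ONLY, such that: if `(u,p)` is a classical
solution of the unit-viscosity unforced Navier–Stokes system on `ℝ³ × [0,T)`, Leray–Hopf on `[0,T)`, with the
global sup-norm Type-I bound `|u(x,t)| ≤ M/√(T − t)`, and `(T,x₀)` is a (backward) singular point, then for ALL
times `t < T` close to `T` the scaled vorticity superlevel set inside the parabolic ball has DEFINITE MEASURE at
the similarity scale: `|{x ∈ B(x₀, R√(T − t)) : (T − t)|ω(x,t)| > d}| ≥ μ (T − t)^{3/2}`.  It implies the door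
Y∞ of ROUND 71 (`SliceVorticityFloorSupTypeI`: the set is non-empty) and, by Chebyshev, the local ENSTROPHY floor
Y_ens (`SliceEnstrophyFloorSupTypeI`: `∫_{B(x₀,R√(T−t))}|ω(t)|² ≥ d²μ/√(T − t)`).  What is known: the every-time
local enstrophy floor with EXPLICIT constants under the Type-I bound in the LORENTZ form `‖u‖_{L^∞_t L^{3,∞}_x} ≤ M₃`
is Barker–Prange 2021 (CMP 385, arXiv:2003.06717 p. 6 and Remark 5 p. 12: `S♯(M₃) = O(1)M₃^{-100}`, suitable
solutions); lower DENSITY bounds for vorticity(-component) superlevel sets cut at a fraction of `‖ω(t)‖_∞`, at the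
scale `‖ω(t)‖_∞^{-1/2}` and SOMEWHERE in space, are the contrapositive of Grujić's sparseness regularity class
(Grujić 2013; Bradshaw–Farhat–Grujić 2019); the qualitative `Ω_d ∩ B(x₀,R√(T − t_n)) ≠ ∅` along one blow-up
sequence is Barker–Prange 2020, proof of Thm 1 Step 4 / (5.3).  New as typed: sup-norm rate, `M`-only constants,
EVERY time near `T`, AT the singular point, a floor on the MEASURE (not only non-emptiness / enstrophy), proved
below WITHOUT a vorticity-gradient bound (Fatou on open superlevel sets through the compactness–rigidity scheme
in `A_M`, fed by door X).  Why it might have failed: a uniform `(R, d, μ)` over the whole sup-norm Type-I class.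
Sources (in prose on purpose — a parameterless typed door must not carry a cite tag): Barker–Prange 2021 (CMP
385) p. 6, Remark 5, Lemma 4, Thm 3; Barker–Prange 2020 (arXiv:1906.08225) §4; Grujić 2013 (Nonlinearity 26);
Bradshaw–Farhat–Grujić 2019 (ARMA 231); Koch–Nadirashvili–Seregin–Šverák 2009, Remark 6.1.  [new-as-typed] -/
def SliceVorticitySuperlevelSupTypeI : Prop :=
  ∀ M : ℝ, ∃ R d μ : ℝ, 0 < R ∧ 0 < d ∧ 0 < μ ∧
    ∀ (T : ℝ) (u : ℝ → EuclideanSpace ℝ (Fin 3) → EuclideanSpace ℝ (Fin 3))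
      (p : ℝ → EuclideanSpace ℝ (Fin 3) → ℝ), 0 < T →
      IsClassicalNSSolutionOn (Ico 0 T) 1 0 u p → IsLerayHopfOn T 1 0 (u 0) u →
      (∀ t ∈ Ioo 0 T, ∀ x : EuclideanSpace ℝ (Fin 3), ‖u t x‖ ≤ M / Real.sqrt (T - t)) →
      ∀ x₀ : EuclideanSpace ℝ (Fin 3), IsBackwardSingularPoint u (T, x₀) →
        ∃ t₁ : ℝ, t₁ < T ∧ ∀ t ∈ Ioo t₁ T,
          ENNReal.ofReal (μ * Real.sqrt (T - t) ^ 3) ≤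
            volume {x ∈ ball x₀ (R * Real.sqrt (T - t)) | d < (T - t) * ‖curl (u t) x‖}

/-- ★★★★ **DOOR Y_μ FROM DOOR X.**  `SliceL3Concentration → SliceVorticitySuperlevelSupTypeI`, with `R(M) = ρ`,
`d(M) = η`, `μ(M) = μ₀/(8q³)` from the constants `(q, ρ, η, μ₀)` of `smallSuperlevel_forces_smallMass` at `(M, R_m(M), γ(M))` of the door X (door X
is CLOSED, `sliceL3Concentration_holds`; the unconditional door Y_μ is `sliceVorticitySuperlevelSupTypeI_holds`).
Proof: if along times `s_n → T` the superlevel set `{(T − s_n)|ω(·,s_n)| > η} ∩ B(x₀, ρ√(T − s_n))` has measure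
`< μ(T − s_n)^{3/2}`, zoom at `(T,x₀)` with the slice `s_n` placed at the rescaled time `−4q²`
(`exists_zoomLimit_at_singular_along_scaled`, `λ_n = √(T − s_n)/(2q)`): the rescaled superlevel sets
`{y ∈ B(0,ρ) : λ_n²|ω(x₀ + λ_n y, s_n)| > η}` have measure `≤ λ_n^{-3} μ (T − s_n)^{3/2} = 8q³μ = ε`
(`volume_superlevel_zoom_lt`), so by the Fatou lemma for strict superlevel sets under the pointwise convergence of
the rescaled vorticities (`measure_superlevel_le_of_tendsto`) the limit `U ∈ A_M` has
`|{y ∈ B(0,ρ) : |curl U(−4q²)| > η}| ≤ ε`, while door X at the rescaled time `−2` gives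
`∫_{B̄(0,R_m√2)}|U(−2)|³ ≥ γ` (scale invariance + dominated convergence) — contradicting
`smallSuperlevel_forces_smallMass`.
[cite: BarkerPrange2020Alignment, §4 Steps 1–5 (arXiv:1906.08225 pp. 16–17); BarkerPrange2021, p. 6 and Remark 5
(arXiv:2003.06717); KochNadirashviliSereginSverak2009, Lemma 3.1 and Remark 6.1] -/
theorem sliceVorticitySuperlevelSupTypeI_of_sliceL3Concentration (hX : SliceL3Concentration) :
    SliceVorticitySuperlevelSupTypeI := by
  intro M
  obtain ⟨γ, Rm, hγ, hRm, hXM⟩ := hX M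
  obtain ⟨q, hq1, ρ, η, ε, hρ, hη, hε, hrig⟩ := smallSuperlevel_forces_smallMass M Rm hγ
  have hq0 : 0 < q := lt_of_lt_of_le one_pos hq1
  refine ⟨ρ, η, ε / (8 * q ^ 3), hρ, hη, by positivity, ?_⟩
  intro T u p hT hcl hLH hI x₀ hsing
  obtain ⟨t₁, ht₁, hmass⟩ := hXM T u p hT hcl hLH hI x₀ hsing
  have hσ₁ : -(4 * q ^ 2) < -1 := by nlinarith [hq1]
  have h2 : (-2 : ℝ) < -1 := by norm_num
  have h20 : (-2 : ℝ) < 0 := by norm_num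
  by_contra hbad
  push Not at hbad
  -- (1) a sequence of bad slices `s n → T`
  have hF := fun n : ℕ => hbad (T - T * (1 / ((n : ℝ) + 1)))
    (by have : 0 < T * (1 / ((n : ℝ) + 1)) := by positivity
        linarith)
  choose s hs hsc using hF
  have hs0 : ∀ n, s n ∈ Ioo 0 T := by
    intro n
    refine ⟨?_, (hs n).2⟩
    have h1 : T * (1 / ((n : ℝ) + 1)) ≤ T := by
      have : 1 / ((n : ℝ) + 1) ≤ 1 := by
        rw [div_le_one (by positivity)]
        linarith [(n.cast_nonneg : (0 : ℝ) ≤ n)]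
      nlinarith
    linarith [(hs n).1]
  have hsT : Tendsto s atTop (𝓝 T) := by
    have hlow : Tendsto (fun n : ℕ => T - T * (1 / ((n : ℝ) + 1))) atTop (𝓝 T) := by
      have h := ((tendsto_one_div_add_atTop_nhds_zero_nat (𝕜 := ℝ)).const_mul T).const_sub T
      rwa [mul_zero, sub_zero] at h
    exact tendsto_of_tendsto_of_tendsto_of_le_of_le hlow tendsto_const_nhds
      (fun n => (hs n).1.le) (fun n => (hs n).2.le)
  -- a tail beyond `t₁`
  obtain ⟨N, hN⟩ : ∃ N : ℕ, ∀ n ≥ N, t₁ < s n :=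
    eventually_atTop.1 (hsT.eventually (Ioi_mem_nhds ht₁))
  set s' : ℕ → ℝ := fun n => s (n + N) with hs'def
  have hs' : ∀ n, s' n ∈ Ioo 0 T := fun n => hs0 (n + N)
  have hs'T : Tendsto s' atTop (𝓝 T) := hsT.comp (tendsto_add_atTop_nat N)
  have hs't₁ : ∀ n, t₁ < s' n := fun n => hN (n + N) (Nat.le_add_left N n)
  have hsc' : ∀ n, volume {x ∈ ball x₀ (ρ * Real.sqrt (T - s' n)) | η < (T - s' n) * ‖curl (u (s' n)) x‖} <
      ENNReal.ofReal (ε / (8 * q ^ 3) * Real.sqrt (T - s' n) ^ 3) := fun n => hsc (n + N)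
  -- (2) zoom along `s'` with the slice at `−4q²`
  obtain ⟨φ, hφ, U, hU, hvel, hcurl⟩ :=
    exists_zoomLimit_at_singular_along_scaled hT hcl hLH hI hsing hs' hs'T hq1
  set lam : ℕ → ℝ := fun j => Real.sqrt (T - s' (φ j)) / (2 * q) with hlamdef
  have hTs : ∀ j, 0 < T - s' (φ j) := fun j => by linarith [(hs' (φ j)).2]
  have hlam : ∀ j, 0 < lam j := fun j => by rw [hlamdef]; exact div_pos (Real.sqrt_pos.2 (hTs j)) (by positivity)
  have hlam2 : ∀ j, lam j ^ 2 = (T - s' (φ j)) / (4 * q ^ 2) := fun j => by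
    rw [hlamdef]
    dsimp only
    rw [div_pow, Real.sq_sqrt (hTs j).le]
    ring
  have e_slice : ∀ j, T + lam j ^ 2 * (-(4 * q ^ 2)) = s' (φ j) := fun j => by
    rw [hlam2]
    field_simp
    ring
  have hlam_le : ∀ j, lam j ≤ Real.sqrt (T - s' (φ j)) := fun j => by
    rw [hlamdef]
    dsimp only
    rw [div_le_iff₀ (by positivity)]
    have := Real.sqrt_nonneg (T - s' (φ j))
    nlinarith
  have hlam2_le : ∀ j, lam j ^ 2 ≤ T - s' (φ j) := fun j => by
    rw [hlam2]
    exact div_le_self (hTs j).le (by nlinarith [hq1])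
  -- (3) the limit slice at `−4q²` has a superlevel set of measure `≤ ε` in `B(0,ρ)` (Fatou)
  have hvolU : volume {y ∈ ball (0 : EuclideanSpace ℝ (Fin 3)) ρ | η < ‖curl (U (-(4 * q ^ 2))) y‖} ≤
      ENNReal.ofReal ε := by
    refine measure_superlevel_le_of_tendsto
      (f := fun j y => ‖lam j ^ 2 • curl (u (T + lam j ^ 2 * (-(4 * q ^ 2)))) (x₀ + lam j • y)‖)
      (fun y _ => (hcurl _ hσ₁ y).norm) (Eventually.of_forall fun j => ?_)
    have hset : {y ∈ ball (0 : EuclideanSpace ℝ (Fin 3)) ρ |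
        η < ‖lam j ^ 2 • curl (u (T + lam j ^ 2 * (-(4 * q ^ 2)))) (x₀ + lam j • y)‖} =
        {y ∈ ball (0 : EuclideanSpace ℝ (Fin 3)) ρ | η < ‖lam j ^ 2 • curl (u (s' (φ j))) (x₀ + lam j • y)‖} := by
      rw [e_slice j]
    rw [hset, volume_superlevel_zoom_lt (curl (u (s' (φ j)))) x₀ (hlam j) ρ η]
    have hsub : {x ∈ ball x₀ (lam j * ρ) | η < lam j ^ 2 * ‖curl (u (s' (φ j))) x‖} ⊆
        {x ∈ ball x₀ (ρ * Real.sqrt (T - s' (φ j))) | η < (T - s' (φ j)) * ‖curl (u (s' (φ j))) x‖} := by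
      intro x hx
      refine ⟨?_, hx.2.trans_le (mul_le_mul_of_nonneg_right (hlam2_le j) (norm_nonneg _))⟩
      have h1 : lam j * ρ ≤ ρ * Real.sqrt (T - s' (φ j)) := by
        rw [mul_comm]; exact mul_le_mul_of_nonneg_left (hlam_le j) hρ.le
      exact ball_subset_ball h1 hx.1
    have hS : 0 < Real.sqrt (T - s' (φ j)) := Real.sqrt_pos.2 (hTs j)
    have e3 : (lam j ^ 3)⁻¹ * (ε / (8 * q ^ 3) * Real.sqrt (T - s' (φ j)) ^ 3) = ε := by
      rw [hlamdef]
      dsimp only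
      field_simp
      norm_num
    calc ENNReal.ofReal (lam j ^ 3)⁻¹ * volume {x ∈ ball x₀ (lam j * ρ) | η < lam j ^ 2 * ‖curl (u (s' (φ j))) x‖}
        ≤ ENNReal.ofReal (lam j ^ 3)⁻¹ *
            volume {x ∈ ball x₀ (ρ * Real.sqrt (T - s' (φ j))) | η < (T - s' (φ j)) * ‖curl (u (s' (φ j))) x‖} :=
          mul_le_mul_of_nonneg_left (measure_mono hsub) (by simp)
      _ ≤ ENNReal.ofReal (lam j ^ 3)⁻¹ * ENNReal.ofReal (ε / (8 * q ^ 3) * Real.sqrt (T - s' (φ j)) ^ 3) :=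
          mul_le_mul_of_nonneg_left (hsc' (φ j)).le (by simp)
      _ = ENNReal.ofReal ε := by
          rw [← ENNReal.ofReal_mul (inv_nonneg.2 (pow_nonneg (hlam j).le 3)), e3]
  -- (4) the limit slice at `−2` has mass `≥ γ` (door X at the times `T − 2λ_j²`)
  have hM0 : 0 ≤ M := by
    have h := hI _ (hs' 0) x₀
    have hsq : 0 < Real.sqrt (T - s' 0) := Real.sqrt_pos.2 (by linarith [(hs' 0).2])
    have := (norm_nonneg _).trans h
    exact (div_nonneg_iff.1 this).elim (fun h => h.1) fun h => by linarith [h.2]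
  have hτT : ∀ j, T + lam j ^ 2 * (-2) < T := fun j => by nlinarith [hlam j]
  have hτs : ∀ j, s' (φ j) < T + lam j ^ 2 * (-2) := fun j => by
    rw [hlam2]
    have h4 : (T - s' (φ j)) / (4 * q ^ 2) ≤ (T - s' (φ j)) / 4 :=
      div_le_div_of_nonneg_left (hTs j).le (by norm_num) (by nlinarith [hq1])
    linarith [hTs j]
  have hτ0 : ∀ j, 0 < T + lam j ^ 2 * (-2) := fun j => (hs' (φ j)).1.trans (hτs j)
  have e_sqrt : ∀ j, Real.sqrt (T - (T + lam j ^ 2 * (-2))) = Real.sqrt 2 * lam j := fun j => by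
    rw [show T - (T + lam j ^ 2 * (-2)) = 2 * lam j ^ 2 by ring, Real.sqrt_mul (by norm_num : (0 : ℝ) ≤ 2),
      Real.sqrt_sq (hlam j).le]
  have hslice : ∀ j, Continuous (u (T + lam j ^ 2 * (-2))) := by
    intro j
    have hc : ContinuousOn (uncurry u) (Ico 0 T ×ˢ univ) := hcl.smooth_velocity.continuousOn
    exact hc.comp_continuous (continuous_const.prodMk continuous_id)
      (fun x : EuclideanSpace ℝ (Fin 3) => (⟨⟨(hτ0 j).le, hτT j⟩, mem_univ x⟩ :
        (T + lam j ^ 2 * (-2), x) ∈ Ico 0 T ×ˢ univ))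
  have hzc : ∀ j, Continuous (fun y : EuclideanSpace ℝ (Fin 3) =>
      lam j • u (T + lam j ^ 2 * (-2)) (x₀ + lam j • y)) := by
    intro j
    have h1 : Continuous (fun y : EuclideanSpace ℝ (Fin 3) => x₀ + lam j • id y) :=
      continuous_const.add (continuous_id.const_smul (lam j))
    exact ((hslice j).comp h1).const_smul (lam j)
  have hzb : ∀ j (y : EuclideanSpace ℝ (Fin 3)), ‖lam j • u (T + lam j ^ 2 * (-2)) (x₀ + lam j • y)‖ ≤
      M / Real.sqrt 2 := by
    intro j y
    have h := hI _ ⟨hτ0 j, hτT j⟩ (x₀ + lam j • y)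
    rw [e_sqrt j, le_div_iff₀ (mul_pos (Real.sqrt_pos.2 (by norm_num)) (hlam j))] at h
    rw [norm_smul, Real.norm_of_nonneg (hlam j).le, le_div_iff₀ (by positivity)]
    calc lam j * ‖u (T + lam j ^ 2 * (-2)) (x₀ + lam j • y)‖ * Real.sqrt 2
        = ‖u (T + lam j ^ 2 * (-2)) (x₀ + lam j • y)‖ * (Real.sqrt 2 * lam j) := by ring
      _ ≤ M := h
  have hzmass : ∀ j, γ ≤ ∫ y in closedBall (0 : EuclideanSpace ℝ (Fin 3)) (Rm * Real.sqrt 2),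
      ‖lam j • u (T + lam j ^ 2 * (-2)) (x₀ + lam j • y)‖ ^ 3 := by
    intro j
    rw [setIntegral_norm_zoom_pow_three (u (T + lam j ^ 2 * (-2))) x₀ (hlam j) (by positivity)]
    have e : lam j * (Rm * Real.sqrt 2) = Rm * Real.sqrt (T - (T + lam j ^ 2 * (-2))) := by
      rw [e_sqrt j]; ring
    rw [e]
    exact hmass _ ⟨(hs't₁ (φ j)).trans (hτs j), hτT j⟩
  have hmassU : γ ≤ ∫ y in closedBall (0 : EuclideanSpace ℝ (Fin 3)) (Rm * Real.sqrt 2), ‖U (-2) y‖ ^ 3 := by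
    have hfin : IsFiniteMeasure (volume.restrict (closedBall (0 : EuclideanSpace ℝ (Fin 3)) (Rm * Real.sqrt 2))) :=
      isFiniteMeasure_restrict.2 measure_closedBall_lt_top.ne
    have hT' : Tendsto (fun j => ∫ y in closedBall (0 : EuclideanSpace ℝ (Fin 3)) (Rm * Real.sqrt 2),
        ‖lam j • u (T + lam j ^ 2 * (-2)) (x₀ + lam j • y)‖ ^ 3)
        atTop (𝓝 (∫ y in closedBall (0 : EuclideanSpace ℝ (Fin 3)) (Rm * Real.sqrt 2), ‖U (-2) y‖ ^ 3)) := by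
      refine tendsto_integral_of_dominated_convergence (fun _ => (M / Real.sqrt 2) ^ 3)
        (fun j => ((hzc j).norm.pow 3).aestronglyMeasurable) (integrable_const _) ?_ ?_
      · intro j
        refine Eventually.of_forall fun y => ?_
        rw [Real.norm_of_nonneg (pow_nonneg (norm_nonneg _) 3)]
        exact pow_le_pow_left₀ (norm_nonneg _) (hzb j y) 3
      · refine Eventually.of_forall fun y => ?_
        have h := hvel (-2) h2 y
        exact (h.norm).pow 3
    exact ge_of_tendsto hT' (Eventually.of_forall hzmass)
  -- (5) contradiction with the measure rigidity in `A_M`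
  have hlt := hrig U hU hvolU
  linarith

/-! ### §M33(d) Y_μ ⇒ Y∞ (a set of positive measure is non-empty) -/

/-- ★★ **DOOR Y_μ IMPLIES DOOR Y∞** (with the same `R, d`): a superlevel set of measure `≥ μ(T − t)^{3/2} > 0`
is non-empty. [new-as-typed] -/
theorem sliceVorticityFloorSupTypeI_of_superlevel (hY : SliceVorticitySuperlevelSupTypeI) :
    SliceVorticityFloorSupTypeI := by
  intro M
  obtain ⟨R, d, μ, hR, hd, hμ, hYM⟩ := hY M
  refine ⟨R, d, hR, hd, ?_⟩
  intro T u p hT hcl hLH hI x₀ hsing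
  obtain ⟨t₁, ht₁, hfl⟩ := hYM T u p hT hcl hLH hI x₀ hsing
  refine ⟨t₁, ht₁, fun t ht => ?_⟩
  have hpos : 0 < ENNReal.ofReal (μ * Real.sqrt (T - t) ^ 3) :=
    ENNReal.ofReal_pos.2 (mul_pos hμ (pow_pos (Real.sqrt_pos.2 (by linarith [ht.2])) 3))
  have hne : volume {x ∈ ball x₀ (R * Real.sqrt (T - t)) | d < (T - t) * ‖curl (u t) x‖} ≠ 0 :=
    (hpos.trans_le (hfl t ht)).ne'
  obtain ⟨x, hx⟩ := nonempty_of_measure_ne_zero hne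
  exact ⟨x, hx.1, hx.2.le⟩

/-! ### §M33(e) Door Y_ens — the local ENSTROPHY floor — from door Y_μ by Chebyshev -/

/-- ★ door **Y_ens** («SIMILARITY-SCALE LOCAL ENSTROPHY FLOOR UNDER THE SUP-NORM TYPE-I RATE»).  For every
`M` there are `R = R(M) > 0`, `e = e(M) > 0`, depending on `M` ONLY, such that at a (backward) singular point
`(T,x₀)` of a classical Leray–Hopf solution on `ℝ³ × [0,T)` with `|u| ≤ M/√(T − t)`, for ALL `t < T` close to
`T`: `∫_{B(x₀, R√(T − t))} |ω(x,t)|² dx ≥ e/√(T − t)`.  What is known: with EXPLICIT constants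
(`R = 4/√S♯`, `e = M₃²√S♯`, `S♯(M₃) = O(1)M₃^{-100}`) under the LORENTZ-form Type-I bound
`‖u‖_{L^∞_t L^{3,∞}_x} ≤ M₃`, for suitable (finite-energy) solutions, this is Barker–Prange 2021 (CMP 385,
arXiv:2003.06717: p. 6 and Remark 5 p. 12, via Jia–Šverák-type local-in-space smoothing, Thm 3 p. 26); under
the sup-norm rate `|u| ≤ M/√(T − t)` (which does not bound `‖u(t)‖_{L^{3,∞}}` by `M`) the `M`-only every-time
floor is typed here and proved (ineffective `e(M)`) from door Y_μ by Chebyshev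
(`sliceEnstrophyFloorSupTypeI_of_superlevel`).  Sources in prose (parameterless typed door, no cite tag):
Barker–Prange 2021 p. 6, Remark 5, Lemma 4, Thm 3; Jia–Šverák 2014; Kang–Miura–Tsai 2021 Thm 1.6; Leray 1934
(3.16).  [new-as-typed] -/
def SliceEnstrophyFloorSupTypeI : Prop :=
  ∀ M : ℝ, ∃ R e : ℝ, 0 < R ∧ 0 < e ∧
    ∀ (T : ℝ) (u : ℝ → EuclideanSpace ℝ (Fin 3) → EuclideanSpace ℝ (Fin 3))
      (p : ℝ → EuclideanSpace ℝ (Fin 3) → ℝ), 0 < T →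
      IsClassicalNSSolutionOn (Ico 0 T) 1 0 u p → IsLerayHopfOn T 1 0 (u 0) u →
      (∀ t ∈ Ioo 0 T, ∀ x : EuclideanSpace ℝ (Fin 3), ‖u t x‖ ≤ M / Real.sqrt (T - t)) →
      ∀ x₀ : EuclideanSpace ℝ (Fin 3), IsBackwardSingularPoint u (T, x₀) →
        ∃ t₁ : ℝ, t₁ < T ∧ ∀ t ∈ Ioo t₁ T,
          e / Real.sqrt (T - t) ≤ ∫ x in ball x₀ (R * Real.sqrt (T - t)), ‖curl (u t) x‖ ^ 2

/-- ★★ **DOOR Y_μ IMPLIES DOOR Y_ens** (Chebyshev), with the same `R` and `e = d²μ`: on the superlevel set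
`|ω|² > d²/(T − t)²`, and the set has measure `≥ μ(T − t)^{3/2}`, so
`∫_{B(x₀,R√(T−t))}|ω(t)|² ≥ (d/(T − t))² μ (T − t)^{3/2} = d²μ/√(T − t)`. [new-as-typed] -/
theorem sliceEnstrophyFloorSupTypeI_of_superlevel (hY : SliceVorticitySuperlevelSupTypeI) :
    SliceEnstrophyFloorSupTypeI := by
  intro M
  obtain ⟨R, d, μ, hR, hd, hμ, hYM⟩ := hY M
  refine ⟨R, d ^ 2 * μ, hR, by positivity, ?_⟩
  intro T u p hT hcl hLH hI x₀ hsing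
  obtain ⟨t₁, ht₁, hfl⟩ := hYM T u p hT hcl hLH hI x₀ hsing
  refine ⟨max t₁ 0, max_lt ht₁ hT, fun t ht => ?_⟩
  have ht₁t : t₁ < t := (le_max_left _ _).trans_lt ht.1
  have ht0 : 0 < t := (le_max_right _ _).trans_lt ht.1
  have hTt : 0 < T - t := by linarith [ht.2]
  have hS : 0 < Real.sqrt (T - t) := Real.sqrt_pos.2 hTt
  set A : Set (EuclideanSpace ℝ (Fin 3)) :=
    {x ∈ ball x₀ (R * Real.sqrt (T - t)) | d < (T - t) * ‖curl (u t) x‖} with hAdef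
  have hflt := hfl t ⟨ht₁t, ht.2⟩
  -- regularity of the slice: `ω(t)` is continuous
  have hcont : Continuous (fun x => ‖curl (u t) x‖ ^ 2) :=
    (continuous_curl ((hcl.contDiff_velocity ⟨ht0.le, ht.2⟩).of_le (by norm_cast))).norm.pow 2
  have hAopen : IsOpen A :=
    isOpen_ball.inter (isOpen_lt continuous_const
      (continuous_const.mul (continuous_curl ((hcl.contDiff_velocity ⟨ht0.le, ht.2⟩).of_le (by norm_cast))).norm))
  have hAsub : A ⊆ ball x₀ (R * Real.sqrt (T - t)) := fun x hx => hx.1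
  have hAfin : volume A < ⊤ := (measure_mono hAsub).trans_lt measure_ball_lt_top
  have hint_ball : IntegrableOn (fun x => ‖curl (u t) x‖ ^ 2) (ball x₀ (R * Real.sqrt (T - t))) volume :=
    (hcont.continuousOn.integrableOn_compact (isCompact_closedBall x₀ _)).mono_set ball_subset_closedBall
  have hint_A : IntegrableOn (fun x => ‖curl (u t) x‖ ^ 2) A volume := hint_ball.mono_set hAsub
  -- the measure floor in real form
  have hvolA : μ * Real.sqrt (T - t) ^ 3 ≤ (volume A).toReal :=
    (ENNReal.ofReal_le_iff_le_toReal hAfin.ne).1 hflt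
  -- Chebyshev
  have hpt : ∀ x ∈ A, (d / (T - t)) ^ 2 ≤ ‖curl (u t) x‖ ^ 2 := by
    intro x hx
    have h1 : d / (T - t) < ‖curl (u t) x‖ := by
      rw [div_lt_iff₀ hTt, mul_comm]; exact hx.2
    exact pow_le_pow_left₀ (by positivity) h1.le 2
  calc d ^ 2 * μ / Real.sqrt (T - t)
      = (d / (T - t)) ^ 2 * (μ * Real.sqrt (T - t) ^ 3) := by
        have hsq : Real.sqrt (T - t) ^ 2 = T - t := Real.sq_sqrt hTt.le
        field_simp
        nlinarith [hsq]
    _ ≤ (d / (T - t)) ^ 2 * (volume A).toReal := mul_le_mul_of_nonneg_left hvolA (by positivity)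
    _ = ∫ x in A, (d / (T - t)) ^ 2 := by
        rw [setIntegral_const, smul_eq_mul, mul_comm, Measure.real]
    _ ≤ ∫ x in A, ‖curl (u t) x‖ ^ 2 :=
        setIntegral_mono_on ((integrableOn_const_iff).2 (Or.inr hAfin)) hint_A hAopen.measurableSet hpt
    _ ≤ ∫ x in ball x₀ (R * Real.sqrt (T - t)), ‖curl (u t) x‖ ^ 2 :=
        setIntegral_mono_set hint_ball (Eventually.of_forall fun x => sq_nonneg _)
          (Eventually.of_forall hAsub)

end Summit.NavierStokesRegularity.NavierStokesRegularity.Theorems.StrainDoors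

end
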